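/-
Copyright (c) 2026 the pub-hodgecm-mathlib formalisation cell (harness21).  Prover seat hodgecm-mathlib-K2E1-p11 (g5), Track B ∕ K2-LIT, h413 = `stmt-HodgeConjecture-24833`,
R90-TF section S8 «ContSpec-n½», sub-socket (R)′ in ESTATE T's currency, S8 dealer R90-CS-plan (g3) deal S8-R215: THE `hEXP` τ-ROW OF ★ p864188 `res_midBlock_le_residual_of_tauAdmissible`
((E4) + (E2-bd) for the GENERATOR'S OWN family `Ec` on `{1 < Re} ∖ Sp`) FROM A PER-GENERATOR EXPORTS ROW — identity theorem on the slit plane minus the exports' pole set, maximum modulus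
principle and Schwarz's lemma at the candidate poles; NO pole-ledger letter is needed because holomorphy of `Ec` on the slit plane is part of the generator datum.
-/
import Summits.HodgeConjecture.HodgeConjecture.Theorems.R90S8ResGMidAtomTauU3Defs                       -- ★ ESTATE T FILE 1 (R90-CS-typ2 ∕ K2E1-p12): `IsTauLevel`, `tauLevel`, `IsArchFinite`
import Summits.HodgeConjecture.HodgeConjecture.Theorems.K2E1ChiEisensteinPoleLedgerCMThree              -- ★ p863972 (K2E2-p12): `continuous_at_removable_of_joint_bound` (Schwarz at a removed point, any parameter space)
import Summits.HodgeConjecture.HodgeConjecture.Theorems.K2E1ConvexDiffCountableConnected                -- ★ `isPreconnected_convex_diff_of_countable`, `countable_of_codiscrete`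
import Summits.HodgeConjecture.HodgeConjecture.Theorems.K2E1ChiEisensteinMeromorphicExportsKFiniteCMThree  -- ★ p864350 (this seat): the K-finite exports head (hypothesis-first on row 1's gauge letters at the block)
import Mathlib.Analysis.Complex.AbsMax
import HarnessLib

/-!
# S8 (R)′ in ESTATE T's currency — `R90S8ResGMidRowsOfTauExportsU3`: THE `hEXP` τ-ROW ((E4) + (E2-bd) on the slit plane for every τ-admissible generator datum) FROM A PER-GENERATOR
# EXPORTS ROW `hTEXP` (the K-finite exports ★ p864350 deliver it at pure-type blocks modulo the gauge ports)

Track B ∕ K2-LIT, crux h413 = `stmt-HodgeConjecture-24833`, route of record `HCCMUnconditional`; cell `hodgecm-mathlib`, R90-TF programme, section S8 «ContSpec-n½», sub-socket (R)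
`sock_S8_res_midBlock_le_residual` (B ED. 7 :337) via ★ p864188 `res_midBlock_le_residual_of_tauAdmissible`.  THEOREMS ONLY (no `def`, no `instance`, no `notation`, no named-fact
hypothesis, no `sorry`; default heartbeats); lane `--supports stmt-HodgeConjecture-24833 --as helper` (count-neutral).  CLOSES NO SOCKET.

THE ROW PAID.  ★ p864188 carries `hEXP`: for every τ-admissible generator datum `(U₀, φ, Ec, Sp, Fp, f)` — in particular `Ec · g` holomorphic on the slit plane `D := {1 < Re} ∖ Sp`
(`Sp ⊂ (1, 2]` finite real) with `Ec z = E(f_z^φ)` on `{2 < Re}` — the rows (E4) «`Ec z` is continuous on `G(𝔸)` for `z ∈ D`» and (E2-bd) «`Ec` is locally jointly bounded at every `z₁ ∈ D`,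
uniformly on compacts».  This file derives that ∀-row from the per-generator EXPORTS row `hTEXP` (§2's binder: for every τ-admissible `(U₀, φ)` SOME continuation `Ec′` with a closed
co-discrete pole set `P ⊆ {Re ≤ 2}`, the tube identity, analyticity, (E4) and (E2-bd) OFF `P` — the clause list of ★ `K2E1ChiEisensteinMeromorphicExportsKFiniteCMThree` at a pure-type block).
THE MATHEMATICS (§1).  `Ec = Ec′` on `D ∖ P` by the identity theorem (both analytic there, equal on the open `{2 < Re} ⊆ D ∖ P`; `D ∖ P = {1 < Re} ∖ (Sp ∪ P)` is an open convex set minus a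
countable set, hence preconnected — ★ `isPreconnected_convex_diff_of_countable`, ★ `countable_of_codiscrete`).  Off `P` the exports' rows transfer verbatim.  At a candidate pole
`z₁ ∈ D ∩ P` the generator datum says `Ec · g` is holomorphic near `z₁` for every `g`: choose a closed ball `B̄(z₁, r) ⊆ D` whose punctured ball misses `P`; its boundary sphere is compact
and lies in `D ∖ P`, so finitely many (E2-bd) patches bound `Ec` on `sphere × K`, and the MAXIMUM MODULUS PRINCIPLE (`Complex.norm_le_of_forall_mem_frontier_norm_le`) carries the bound
inside the ball — this is (E2-bd) at `z₁`; then (E4) at `z₁` is ★ `continuous_at_removable_of_joint_bound` (Schwarz's lemma; `G(𝔸)` locally compact).  No «fake poles are removable»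
letter enters: holomorphy on `D` is a HYPOTHESIS of the row.
* §1 **`rowsE4Ebd_slit_of_exports`** (generic `Ec, Ec′, Sp ⊆ {Re ≤ 2}, P`): the two rows on `D` for `Ec`.
* §2 **`hEXP_tauRow_of_exportsRow (hTEXP)`** ⊢ ★ p864188's `hEXP` ∀-row BYTE FOR BYTE (any pair `(χ₁, χ₂)`; the consumer writes `hEXP := hEXP_tauRow_of_exportsRow L μ hTEXP`).
* §3 **`exportsTauRow_of_gauge_blocks`** — `hTEXP` at the exports' frame from the BLOCK LETTER `hBLOCK` «every τ-admissible generator lies in a finite-dimensional `K_max`-stable block of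
  continuous bounded pair-sections carrying row 1's gauge letters `hfam` ∕ `hnc` AT the block» (★ p864350 at the block); **`hEXP_tauRow_of_gauge_blocks`** = §3 ∘ §2.
VISIBLE LETTERS: `hTEXP` (§2) ∕ `hBLOCK` (§3) — at PURE-TYPE generators `hTEXP` is ★ p864350 `chiEisenstein_meromorphic_exports_kfinite_cm_three_of_gauge_letters` (modulo row 1's gauge letters at the block = the
τ-ports of K2E1-p15 (g4) ∕ K2E2-p12 (g10)); at general K-finite generators via K2E1-p12 (g6)'s splitting + additivity of this row shape (sequel).
HONEST LABEL: HC_CM is proved only modulo the 7 printed citations (2 remaining named inputs: hLiu418 = `stmt-HodgeConjecture-24832`, h413 = `stmt-HodgeConjecture-24833`) until rung 0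
closes; REL ≠ ★ ≠ BUILT; this file pays the `hEXP` row of (R)′ modulo `hTEXP` and closes no socket; count-neutral.

## References
* [MoeglinWaldspurger1995] C. Mœglin, J.-L. Waldspurger, *Spectral Decomposition and Eisenstein Series* (1995), IV.1.9–IV.1.11.
* [BernsteinLapid2019] J. Bernstein, E. Lapid, *On the meromorphic continuation of Eisenstein series*, J. Amer. Math. Soc. 37 (2024), Thm 2.3, §4 p. 10.
* [Conway1978] J. B. Conway, *Functions of One Complex Variable* (2nd ed., 1978), IV §3 (identity theorem), VI §1–§2 (maximum modulus, Schwarz).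
-/

set_option autoImplicit false
set_option linter.dupNamespace false  -- the mandated namespace `…HodgeConjecture.HodgeConjecture.R90.S8` (LEAD #1 L1) repeats the summit's segment

noncomputable section

open MeasureTheory Measure NumberField IsDedekindDomain Set Filter Topology
open scoped ENNReal NNReal
open Literature.NumberTheory Literature.NumberTheory.Automorphic Literature.NumberTheory.Automorphic.UnitaryGroup Literature.NumberTheory.GaloisRepresentations AdelicGroupData
open Literature.NumberTheory.Automorphic.Arthur2013.Leaves.TECR
open Summit.HodgeConjecture.HodgeConjecture.Cruxes.H413.K2E1BorelEisensteinU
open Summit.HodgeConjecture.HodgeConjecture.Cruxes.H413.K2E1CharacterEisensteinU3PairDefs Summit.HodgeConjecture.HodgeConjecture.Cruxes.H413.K2E1ChiSectionSpaceU3PairDefs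
open Summit.HodgeConjecture.HodgeConjecture.Cruxes.H413.K2E1ChiEisensteinPoleLedgerCMThree (continuous_at_removable_of_joint_bound)
open Summit.HodgeConjecture.HodgeConjecture.Cruxes.H413.K2E1ConvexDiffCountableConnected (isPreconnected_convex_diff_of_countable countable_of_codiscrete)
open Summit.HodgeConjecture.HodgeConjecture.Cruxes.H413.K2E1ChiEisensteinMeromorphicExportsKFiniteCMThree (chiEisenstein_meromorphic_exports_kfinite_cm_three_of_gauge_letters)
open Summit.HodgeConjecture.HodgeConjecture.Cruxes.H413.K2E1BLBorelSpacesU2Defs Summit.HodgeConjecture.HodgeConjecture.Cruxes.H413.K2E1BLBorelOperatorsU2Defs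
open Literature.MeasureTheory.Group

namespace Summit.HodgeConjecture.HodgeConjecture.R90.S8

variable (L : Type) [Field L] [NumberField L] [IsCMField L]

/-! ## §1 The two rows on the slit plane for the generator's own family -/

/-- **(E4) AND (E2-bd) ON THE SLIT PLANE FOR THE GENERATOR'S OWN FAMILY** (generic): if `Ec · g` is holomorphic on `D := {1 < Re} ∖ Sp` (`Sp ⊆ {Re ≤ 2}`) for every `g` and agrees with
`Ec′` on `{2 < Re}`, where `Ec′ · g` is analytic off a closed co-discrete `P ⊆ {Re ≤ 2}` with (E4) and (E2-bd) OFF `P`, then (E4) and (E2-bd) hold for `Ec` at EVERY point of `D` —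
identity theorem on the preconnected `D ∖ P`, maximum modulus on small balls around the candidate poles (boundary spheres in `D ∖ P`), Schwarz's lemma for (E4) at those points.
[cite: Conway1978, IV §3, VI §1–§2] [cite: MoeglinWaldspurger1995, IV.1.9–IV.1.11] [cite: BernsteinLapid2019, §4 p. 10] -/
theorem rowsE4Ebd_slit_of_exports {Ec Ec' : ℂ → (quasiSplit (↥(maximalRealSubfield L)) L (IsCMField.complexConj L) 3).Adelic → ℂ} {Sp : Finset ℂ} (hSp : ∀ s ∈ Sp, s.re ≤ 2)
    (hhol : ∀ g, DifferentiableOn ℂ (fun z => Ec z g) ({z : ℂ | 1 < z.re} \ (↑Sp : Set ℂ))) (hagree : ∀ z : ℂ, 2 < z.re → ∀ g, Ec z g = Ec' z g)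
    {P : Set ℂ} (hPc : IsClosed P) (hPcd : ∀ z₀ : ℂ, ∀ᶠ s in 𝓝[≠] z₀, s ∉ P) (hPre : ∀ z ∈ P, z.re ≤ 2)
    (hEan : ∀ g (z : ℂ), z ∉ P → AnalyticAt ℂ (fun z => Ec' z g) z) (hE4 : ∀ z : ℂ, z ∉ P → Continuous (Ec' z))
    (hEbd : ∀ z₁ : ℂ, z₁ ∉ P → ∀ K : Set (quasiSplit (↥(maximalRealSubfield L)) L (IsCMField.complexConj L) 3).Adelic, IsCompact K → ∃ V ∈ 𝓝 z₁, ∃ M : ℝ, ∀ z ∈ V, ∀ g ∈ K, ‖Ec' z g‖ ≤ M) :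
    (∀ z ∈ ({z : ℂ | 1 < z.re} \ (↑Sp : Set ℂ)), Continuous (Ec z)) ∧
      (∀ z₁ ∈ ({z : ℂ | 1 < z.re} \ (↑Sp : Set ℂ)), ∀ K : Set (quasiSplit (↥(maximalRealSubfield L)) L (IsCMField.complexConj L) 3).Adelic, IsCompact K → ∃ V ∈ 𝓝 z₁, ∃ M : ℝ, ∀ z ∈ V, ∀ g ∈ K, ‖Ec z g‖ ≤ M) := by
  haveI : LocallyCompactSpace (quasiSplit (↥(maximalRealSubfield L)) L (IsCMField.complexConj L) 3).Adelic :=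
    inferInstanceAs (LocallyCompactSpace (adelic (↥(maximalRealSubfield L)) L (IsCMField.complexConj L) 3 ((StdForm.antidiagonal 3).over L)))
  set D : Set ℂ := {z : ℂ | 1 < z.re} \ (↑Sp : Set ℂ) with hD
  have hHo : IsOpen {z : ℂ | 1 < z.re} := isOpen_lt continuous_const Complex.continuous_re
  have hDo : IsOpen D := hHo.sdiff Sp.finite_toSet.isClosed
  have hDPo : IsOpen (D \ P) := hDo.sdiff hPc
  -- the identity theorem on `D ∖ P`
  have hpre : IsPreconnected (D \ P) := by
    rw [hD, sdiff_sdiff_left]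
    show IsPreconnected ({z : ℂ | 1 < z.re} \ ((↑Sp : Set ℂ) ∪ P))
    exact isPreconnected_convex_diff_of_countable Literature.Topology.Euclidean.one_lt_rank_real_complex (convex_halfSpace_re_gt 1) hHo
      (Sp.finite_toSet.countable.union (countable_of_codiscrete hPcd))
  have h3 : (3 : ℂ) ∈ D \ P := by
    refine ⟨⟨?_, fun h => ?_⟩, fun h => ?_⟩
    · show (1 : ℝ) < (3 : ℂ).re
      norm_num
    · have h' := hSp _ h
      norm_num at h'
    · have h' := hPre _ h
      norm_num at h'
  have heq : ∀ z ∈ D \ P, ∀ g, Ec z g = Ec' z g := fun z hz g => by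
    have hanE : AnalyticOnNhd ℂ (fun w => Ec w g) (D \ P) := fun w hw => (hhol g).analyticAt (hDo.mem_nhds hw.1)
    have hanE' : AnalyticOnNhd ℂ (fun w => Ec' w g) (D \ P) := fun w hw => hEan g w hw.2
    have hev : (fun w => Ec w g) =ᶠ[𝓝 (3 : ℂ)] fun w => Ec' w g := by
      have hm : {w : ℂ | 2 < w.re} ∈ 𝓝 (3 : ℂ) := (isOpen_lt continuous_const Complex.continuous_re).mem_nhds (by show (2 : ℝ) < (3 : ℂ).re; norm_num)
      filter_upwards [hm] with w hw using hagree w hw g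
    exact hanE.eqOn_of_preconnected_of_eventuallyEq hanE' hpre h3 hev hz
  -- off `P`: transfer verbatim
  have hE4D : ∀ z ∈ D \ P, Continuous (Ec z) := fun z hz => by
    have h : Ec z = Ec' z := funext (heq z hz)
    rw [h]
    exact hE4 z hz.2
  have hEbdD : ∀ z₁ ∈ D \ P, ∀ K : Set (quasiSplit (↥(maximalRealSubfield L)) L (IsCMField.complexConj L) 3).Adelic, IsCompact K → ∃ V ∈ 𝓝 z₁, ∃ M : ℝ, ∀ z ∈ V, ∀ g ∈ K, ‖Ec z g‖ ≤ M := fun z₁ hz₁ K hK => by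
    obtain ⟨V, hV, M, hM⟩ := hEbd z₁ hz₁.2 K hK
    refine ⟨V ∩ (D \ P), inter_mem hV (hDPo.mem_nhds hz₁), M, fun z hz g hg => ?_⟩
    rw [heq z hz.2 g]
    exact hM z hz.1 g hg
  -- at a candidate pole of `D`: maximum modulus on a small ball whose boundary sphere lies in `D ∖ P`
  have hEbdP : ∀ z₁ ∈ D, z₁ ∈ P → ∀ K : Set (quasiSplit (↥(maximalRealSubfield L)) L (IsCMField.complexConj L) 3).Adelic, IsCompact K → ∃ V ∈ 𝓝 z₁, ∃ M : ℝ, ∀ z ∈ V, ∀ g ∈ K, ‖Ec z g‖ ≤ M := by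
    intro z₁ hz₁D _ K hK
    obtain ⟨r₁, hr₁, hr₁D⟩ := Metric.nhds_basis_closedBall.mem_iff.1 (hDo.mem_nhds hz₁D)
    obtain ⟨ε, hε, hεP⟩ := Metric.eventually_nhds_iff.1 (eventually_nhdsWithin_iff.1 (hPcd z₁))
    set r : ℝ := min r₁ (ε / 2) with hr
    have hr0 : 0 < r := lt_min hr₁ (half_pos hε)
    have hball : Metric.closedBall z₁ r ⊆ D := (Metric.closedBall_subset_closedBall (min_le_left _ _)).trans hr₁D
    have hpunct : ∀ z ∈ Metric.closedBall z₁ r, z ≠ z₁ → z ∉ P := fun z hz hne =>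
      hεP (lt_of_le_of_lt (Metric.mem_closedBall.1 hz) (lt_of_le_of_lt (min_le_right _ _) (half_lt_self hε))) hne
    have hSsub : Metric.sphere z₁ r ⊆ D \ P := fun ζ hζ =>
      ⟨hball (Metric.sphere_subset_closedBall hζ), hpunct ζ (Metric.sphere_subset_closedBall hζ) fun h => by
        rw [h, Metric.mem_sphere, dist_self] at hζ
        exact hr0.ne hζ⟩
    -- finitely many (E2-bd) patches cover the sphere
    choose! V hV M hM using fun ζ (hζ : ζ ∈ D \ P) => hEbdD ζ hζ K hK
    obtain ⟨t, htS, hcover⟩ := (isCompact_sphere z₁ r).elim_nhds_subcover V fun ζ hζ => hV ζ (hSsub hζ)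
    set C : ℝ := ∑ ζ ∈ t, |M ζ| with hC
    have hsphere : ∀ ζ ∈ Metric.sphere z₁ r, ∀ g ∈ K, ‖Ec ζ g‖ ≤ C := fun ζ hζ g hg => by
      obtain ⟨ζ₀, hζ₀t, hζV⟩ := mem_iUnion₂.1 (hcover hζ)
      exact (hM ζ₀ (hSsub (htS ζ₀ hζ₀t)) ζ hζV g hg).trans ((le_abs_self _).trans (Finset.single_le_sum (fun i _ => abs_nonneg (M i)) hζ₀t))
    -- maximum modulus principle on `ball z₁ r`
    refine ⟨Metric.ball z₁ r, Metric.ball_mem_nhds z₁ hr0, C, fun z hz g hg => ?_⟩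
    refine Complex.norm_le_of_forall_mem_frontier_norm_le Metric.isBounded_ball ((hhol g).diffContOnCl_ball hball) (fun ζ hζ => ?_) (subset_closure hz)
    rw [frontier_ball z₁ hr0.ne'] at hζ
    exact hsphere ζ hζ g hg
  -- (E4) at a candidate pole: Schwarz (★ `continuous_at_removable_of_joint_bound`)
  have hE4P : ∀ z₁ ∈ D, z₁ ∈ P → Continuous (Ec z₁) := fun z₁ hz₁D hz₁P => by
    refine continuous_at_removable_of_joint_bound Ec (fun g => (hhol g).analyticAt (hDo.mem_nhds hz₁D)) ?_ fun K hK => ?_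
    · filter_upwards [hPcd z₁, mem_nhdsWithin_of_mem_nhds (hDo.mem_nhds hz₁D)] with z hzP hzD
      exact ⟨fun g => ((hhol g).analyticAt (hDo.mem_nhds hzD)).differentiableAt, hE4D z ⟨hzD, hzP⟩⟩
    · obtain ⟨V, hV, M, hM⟩ := hEbdP z₁ hz₁D hz₁P K hK
      exact ⟨M, (Filter.eventually_of_mem hV fun z hz g hg => hM z hz g hg).filter_mono nhdsWithin_le_nhds⟩
  refine ⟨fun z hz => ?_, fun z₁ hz₁ K hK => ?_⟩
  · by_cases hzP : z ∈ P
    · exact hE4P z hz hzP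
    · exact hE4D z ⟨hz, hzP⟩
  · by_cases hzP : z₁ ∈ P
    · exact hEbdP z₁ hz₁ hzP K hK
    · exact hEbdD z₁ ⟨hz₁, hzP⟩ K hK

/-! ## §2 The `hEXP` τ-row of ★ p864188 from the per-generator exports row -/

/-- **THE `hEXP` τ-ROW OF ★ `res_midBlock_le_residual_of_tauAdmissible`, FROM THE PER-GENERATOR EXPORTS ROW `hTEXP`**: for any pair `(χ₁, χ₂)`, if every τ-admissible generator
`(U₀, φ)` (`IsTauLevel U₀`, `φ ∈ V(χ₁, χ₂; tauLevel U₀, 1)` continuous, `IsArchFinite φ`) has SOME continuation `Ec′` of `z ↦ E(f_z^φ)` with a closed co-discrete pole set `P ⊆ {Re ≤ 2}`,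
analyticity, (E4) and (E2-bd) off `P` (the clause list of ★ `K2E1ChiEisensteinMeromorphicExportsKFiniteCMThree`), then ★ p864188's `hEXP` ∀-row holds BYTE FOR BYTE: for every generator
DATUM `(U₀, φ, Ec, Sp, …)`, (E4) and (E2-bd) for ITS `Ec` on `{1 < Re} ∖ Sp` (§1). [cite: MoeglinWaldspurger1995, IV.1.9–IV.1.11] [cite: BernsteinLapid2019, Thm 2.3, §4 p. 10] -/
theorem hEXP_tauRow_of_exportsRow (μ : Measure (quasiSplit (↥(maximalRealSubfield L)) L (IsCMField.complexConj L) 3).automorphicQuotient)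
    {χ₁ : HeckeCharacter L} {χ₂ : ↥(TorusDict.torus (IsCMField.complexConj L)) →ₜ* ℂˣ}
    (hTEXP : ∀ (U₀ : Subgroup ↥(finAdelic (↥(maximalRealSubfield L)) L (IsCMField.complexConj L) 3 ((StdForm.antidiagonal 3).over L))) (_ : IsTauLevel L U₀)
      (φ : (quasiSplit (↥(maximalRealSubfield L)) L (IsCMField.complexConj L) 3).Adelic → ℂ) (_ : φ ∈ chiSectionSpacePair χ₁ χ₂ (tauLevel L U₀) ((1 : ↥(tauLevel L U₀) →* ℂ) : ↥(tauLevel L U₀) → ℂ)) (_ : Continuous φ)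
      (_ : IsArchFinite L φ),
      ∃ (Ec' : ℂ → (quasiSplit (↥(maximalRealSubfield L)) L (IsCMField.complexConj L) 3).Adelic → ℂ) (P : Set ℂ), IsClosed P ∧ (∀ z₀ : ℂ, ∀ᶠ s in 𝓝[≠] z₀, s ∉ P) ∧ (∀ z ∈ P, z.re ≤ 2) ∧
        (∀ z : ℂ, 2 < z.re → Ec' z = eisensteinSeriesU (flatSectionU φ z)) ∧ (∀ g (z : ℂ), z ∉ P → AnalyticAt ℂ (fun z => Ec' z g) z) ∧
        (∀ z : ℂ, z ∉ P → Continuous (Ec' z)) ∧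
        (∀ z₁ : ℂ, z₁ ∉ P → ∀ K : Set (quasiSplit (↥(maximalRealSubfield L)) L (IsCMField.complexConj L) 3).Adelic, IsCompact K → ∃ V ∈ 𝓝 z₁, ∃ M : ℝ, ∀ z ∈ V, ∀ g ∈ K, ‖Ec' z g‖ ≤ M)) :
    ∀ (U₀ : Subgroup ↥(finAdelic (↥(maximalRealSubfield L)) L (IsCMField.complexConj L) 3 ((StdForm.antidiagonal 3).over L))) (_ : IsTauLevel L U₀)
      (φ : (quasiSplit (↥(maximalRealSubfield L)) L (IsCMField.complexConj L) 3).Adelic → ℂ) (_ : φ ∈ chiSectionSpacePair χ₁ χ₂ (tauLevel L U₀) ((1 : ↥(tauLevel L U₀) →* ℂ) : ↥(tauLevel L U₀) → ℂ)) (_ : Continuous φ)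
      (_ : IsArchFinite L φ)
      (Ec : ℂ → (quasiSplit (↥(maximalRealSubfield L)) L (IsCMField.complexConj L) 3).Adelic → ℂ) (Sp : Finset ℂ) (_ : ∀ s ∈ Sp, s.im = 0 ∧ 1 < s.re ∧ s.re ≤ 2)
      (_ : ∀ g, DifferentiableOn ℂ (fun z => Ec z g) ({z : ℂ | 1 < z.re} \ (↑Sp : Set ℂ)))
      (_ : ∀ z : ℂ, 2 < z.re → Ec z = eisensteinSeriesU (flatSectionU φ z))
      (Fp : (quasiSplit (↥(maximalRealSubfield L)) L (IsCMField.complexConj L) 3).Adelic → ℂ → ℂ) (_ : ∀ g, AnalyticAt ℂ (Fp g) ((3 : ℂ) / 2))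
      (_ : ∀ g, Fp g =ᶠ[𝓝[≠] ((3 : ℂ) / 2)] fun z => (z - (3 : ℂ) / 2) * Ec z g)
      (f : (quasiSplit (↥(maximalRealSubfield L)) L (IsCMField.complexConj L) 3).L2 μ) (_ : (f : (quasiSplit (↥(maximalRealSubfield L)) L (IsCMField.complexConj L) 3).automorphicQuotient → ℂ) =ᵐ[μ] fun x => Fp (Quotient.out (x : (quasiSplit (↥(maximalRealSubfield L)) L (IsCMField.complexConj L) 3).Adelic ⧸ (quasiSplit (↥(maximalRealSubfield L)) L (IsCMField.complexConj L) 3).quotientSubgroup))⁻¹ ((3 : ℂ) / 2)), (∀ z ∈ ({z : ℂ | 1 < z.re} \ (↑Sp : Set ℂ)), Continuous (Ec z)) ∧ (∀ z₁ ∈ ({z : ℂ | 1 < z.re} \ (↑Sp : Set ℂ)), ∀ K : Set (quasiSplit (↥(maximalRealSubfield L)) L (IsCMField.complexConj L) 3).Adelic, IsCompact K → ∃ V ∈ 𝓝 z₁, ∃ M : ℝ, ∀ z ∈ V, ∀ g ∈ K, ‖Ec z g‖ ≤ M) := by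
  intro U₀ hU₀ φ hφV hφc hfin Ec Sp hSp hhol hEis Fp _hFp _hFpE f _hf
  obtain ⟨Ec', P, hPc, hPcd, hPre, hE2', hEan, hE4, hEbd⟩ := hTEXP U₀ hU₀ φ hφV hφc hfin
  exact rowsE4Ebd_slit_of_exports L (fun s hs => (hSp s hs).2.2) hhol (fun z hz g => by rw [hEis z hz, hE2' z hz]) hPc hPcd hPre hEan hE4 hEbd

/-! ## §3 The exports row at PURE-TYPE generators, from the K-finite exports head ★ p864350 (modulo the gauge letters of each block) -/

/-- **`hTEXP` AT PURE-TYPE τ-ADMISSIBLE GENERATORS** (the frame of ★ `_of_letters_of_eigen_with_bound`; `χ₂` automorphic): if every τ-admissible generator `φ` lies in a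
finite-dimensional `K_max`-stable block `V` of continuous bounded `(χ₁, χ₂)`-pair-sections carrying row 1's gauge letters `hfam` ∕ `hnc` AT `V` (the BLOCK LETTER `hBLOCK` — pure-type blocks
get the gauge letters from the τ-ports of K2E1-p15 (g4) ∕ K2E2-p12 (g10) over ★ (α); the block itself from K2E1-p12 (g6)'s laws), then the per-generator exports row `hTEXP` of §2 holds —
★ `chiEisenstein_meromorphic_exports_kfinite_cm_three_of_gauge_letters` at `V`. [cite: BernsteinLapid2019, Thm 2.3, §4, §7] [cite: MoeglinWaldspurger1995, II.1.7, IV.1.8–IV.1.11] -/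
theorem exportsTauRow_of_gauge_blocks
    [MeasurableSpace (quasiSplit (↥(maximalRealSubfield L)) L (IsCMField.complexConj L) 3).Adelic] [BorelSpace (quasiSplit (↥(maximalRealSubfield L)) L (IsCMField.complexConj L) 3).Adelic]
    (μ : Measure (quasiSplit (↥(maximalRealSubfield L)) L (IsCMField.complexConj L) 3).automorphicQuotient) [(quasiSplit (↥(maximalRealSubfield L)) L (IsCMField.complexConj L) 3).IsAutomorphicMeasure μ]
    (νG : Measure (quasiSplit (↥(maximalRealSubfield L)) L (IsCMField.complexConj L) 3).Adelic) [νG.IsHaarMeasure] [νG.IsInvInvariant] [SFinite νG]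
    (ν : Measure ↥(adelicUnipotent (↥(maximalRealSubfield L)) L (IsCMField.complexConj L) 3)) [ν.IsHaarMeasure] [ν.IsMulRightInvariant] [ν.IsInvInvariant]
    {𝓕 : Set ↥(adelicUnipotent (↥(maximalRealSubfield L)) L (IsCMField.complexConj L) 3)}
    (h𝓕N : IsFundamentalDomain ↥(rationalUnipotent (↥(maximalRealSubfield L)) L (IsCMField.complexConj L) 3) 𝓕 ν) (h𝓕c : IsCompact (closure 𝓕)) (h𝓕₀ : ν 𝓕 ≠ 0)
    {β : (quasiSplit (↥(maximalRealSubfield L)) L (IsCMField.complexConj L) 3).Adelic → ℝ≥0∞}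
    (hβ : IsCoveringWeight ↥((arithmeticBorel (↥(maximalRealSubfield L)) L (IsCMField.complexConj L) 3).map (quasiSplit (↥(maximalRealSubfield L)) L (IsCMField.complexConj L) 3).arithmeticSubgroup.subtype) β)
    {μZ : Measure (borelQuotient (↥(maximalRealSubfield L)) L (IsCMField.complexConj L) 3)} [SFinite μZ]
    (hμZ : ∀ f : borelQuotient (↥(maximalRealSubfield L)) L (IsCMField.complexConj L) 3 → ℝ≥0∞, Measurable f → ∫⁻ z, f z ∂μZ = ∫⁻ g, β g * f (toBorelQuotient (↥(maximalRealSubfield L)) L (IsCMField.complexConj L) 3 g) ∂νG)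
    {χ₁ : HeckeCharacter L} {χ₂ : ↥(TorusDict.torus (IsCMField.complexConj L)) →ₜ* ℂˣ} (hχ₂ : TorusDict.IsAutomorphic (IsCMField.complexConj L) χ₂)
    -- THE BLOCK LETTER: every τ-admissible generator lies in a f.d. `K_max`-stable block of continuous bounded pair-sections carrying row 1's gauge letters AT the block
    (hBLOCK : ∀ (U₀ : Subgroup ↥(finAdelic (↥(maximalRealSubfield L)) L (IsCMField.complexConj L) 3 ((StdForm.antidiagonal 3).over L))) (_ : IsTauLevel L U₀)
      (φ : (quasiSplit (↥(maximalRealSubfield L)) L (IsCMField.complexConj L) 3).Adelic → ℂ) (_ : φ ∈ chiSectionSpacePair χ₁ χ₂ (tauLevel L U₀) ((1 : ↥(tauLevel L U₀) →* ℂ) : ↥(tauLevel L U₀) → ℂ)) (_ : Continuous φ)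
      (_ : IsArchFinite L φ),
      ∃ V : Submodule ℂ ((quasiSplit (↥(maximalRealSubfield L)) L (IsCMField.complexConj L) 3).Adelic → ℂ), FiniteDimensional ℂ ↥V ∧ φ ∈ V ∧
        (∀ k ∈ ((standardMaximalCompactGL 3 L).comap (adelicVal (↥(maximalRealSubfield L)) L (IsCMField.complexConj L) 3 ((StdForm.antidiagonal 3).over L)) : Subgroup (quasiSplit (↥(maximalRealSubfield L)) L (IsCMField.complexConj L) 3).Adelic), ∀ ψ ∈ V, (fun x => ψ (x * k)) ∈ V) ∧
        (∀ ψ ∈ V, IsChiSectionPair χ₁ χ₂ ψ) ∧ (∀ ψ ∈ V, Continuous ψ) ∧ (∀ ψ ∈ V, ∃ M : ℝ, ∀ x, ‖ψ x‖ ≤ M) ∧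
        (∀ z₀ : ℂ, ∃ η : GL (Fin 3) (AdeleRing (𝓞 L) L) → ℝ, IsTestFunctionGL 3 L η ∧ (∀ g, 0 ≤ η g) ∧ (∀ g, η g⁻¹ = η g) ∧
      ∃ s : ℂ → ℂ, Differentiable ℂ s ∧ s z₀ ≠ 0 ∧ ∀ z : ℂ, ∀ φ ∈ V, ∀ x : (quasiSplit (↥(maximalRealSubfield L)) L (IsCMField.complexConj L) 3).Adelic, (∫ y, (fun y : (quasiSplit (↥(maximalRealSubfield L)) L (IsCMField.complexConj L) 3).Adelic => orbitalSmoothing νG (fun x : (quasiSplit (↥(maximalRealSubfield L)) L (IsCMField.complexConj L) 3).Adelic => ((η (adelicVal (↥(maximalRealSubfield L)) L (IsCMField.complexConj L) 3 ((StdForm.antidiagonal 3).over L) x) : ℝ) : ℂ)) (fun x : (quasiSplit (↥(maximalRealSubfield L)) L (IsCMField.complexConj L) 3).Adelic => ((η (adelicVal (↥(maximalRealSubfield L)) L (IsCMField.complexConj L) 3 ((StdForm.antidiagonal 3).over L) x) : ℝ) : ℂ)) y) y * flatSectionU φ z (x * y) ∂νG) = s z * flatSectionU φ z x) ∧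
        (∃ η : GL (Fin 3) (AdeleRing (𝓞 L) L) → ℝ, IsTestFunctionGL 3 L η ∧ (∀ g, 0 ≤ η g) ∧ (∀ g, η g⁻¹ = η g) ∧
      ∃ s : ℂ → ℂ, Differentiable ℂ s ∧ (∃ z₁ z₂ : ℂ, s z₁ ≠ s z₂) ∧ ∀ z : ℂ, ∀ φ ∈ V, ∀ x : (quasiSplit (↥(maximalRealSubfield L)) L (IsCMField.complexConj L) 3).Adelic, (∫ y, (fun y : (quasiSplit (↥(maximalRealSubfield L)) L (IsCMField.complexConj L) 3).Adelic => orbitalSmoothing νG (fun x : (quasiSplit (↥(maximalRealSubfield L)) L (IsCMField.complexConj L) 3).Adelic => ((η (adelicVal (↥(maximalRealSubfield L)) L (IsCMField.complexConj L) 3 ((StdForm.antidiagonal 3).over L) x) : ℝ) : ℂ)) (fun x : (quasiSplit (↥(maximalRealSubfield L)) L (IsCMField.complexConj L) 3).Adelic => ((η (adelicVal (↥(maximalRealSubfield L)) L (IsCMField.complexConj L) 3 ((StdForm.antidiagonal 3).over L) x) : ℝ) : ℂ)) y) y * flatSectionU φ z (x * y) ∂νG) = s z * flatSectionU φ z x))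 :
    ∀ (U₀ : Subgroup ↥(finAdelic (↥(maximalRealSubfield L)) L (IsCMField.complexConj L) 3 ((StdForm.antidiagonal 3).over L))) (_ : IsTauLevel L U₀)
      (φ : (quasiSplit (↥(maximalRealSubfield L)) L (IsCMField.complexConj L) 3).Adelic → ℂ) (_ : φ ∈ chiSectionSpacePair χ₁ χ₂ (tauLevel L U₀) ((1 : ↥(tauLevel L U₀) →* ℂ) : ↥(tauLevel L U₀) → ℂ)) (_ : Continuous φ)
      (_ : IsArchFinite L φ),
      ∃ (Ec' : ℂ → (quasiSplit (↥(maximalRealSubfield L)) L (IsCMField.complexConj L) 3).Adelic → ℂ) (P : Set ℂ), IsClosed P ∧ (∀ z₀ : ℂ, ∀ᶠ s in 𝓝[≠] z₀, s ∉ P) ∧ (∀ z ∈ P, z.re ≤ 2) ∧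
        (∀ z : ℂ, 2 < z.re → Ec' z = eisensteinSeriesU (flatSectionU φ z)) ∧ (∀ g (z : ℂ), z ∉ P → AnalyticAt ℂ (fun z => Ec' z g) z) ∧
        (∀ z : ℂ, z ∉ P → Continuous (Ec' z)) ∧
        (∀ z₁ : ℂ, z₁ ∉ P → ∀ K : Set (quasiSplit (↥(maximalRealSubfield L)) L (IsCMField.complexConj L) 3).Adelic, IsCompact K → ∃ V ∈ 𝓝 z₁, ∃ M : ℝ, ∀ z ∈ V, ∀ g ∈ K, ‖Ec' z g‖ ≤ M) := by
  intro U₀ hU₀ φ hφV hφc hfin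
  obtain ⟨V, hVfd, hφ, hVK, hVχ, hVc, hVM, hfam, hnc⟩ := hBLOCK U₀ hU₀ φ hφV hφc hfin
  haveI := hVfd
  obtain ⟨n, φ', q, Ec, qc, P, -, -, -, -, -, -, -, -, hEcE, -, hPc, hPcd, hPre, hEan, -, -, -, hEcont, hEbd⟩ :=
    chiEisenstein_meromorphic_exports_kfinite_cm_three_of_gauge_letters L μ νG ν h𝓕N h𝓕c h𝓕₀ hβ hμZ hχ₂ V hVK hVχ hVc hVM hfam hnc hφ
  exact ⟨Ec, P, hPc, hPcd, hPre, hEcE, hEan, hEcont, hEbd⟩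

/-- **THE `hEXP` τ-ROW FROM THE BLOCK LETTER** (§3 ∘ §2): at the exports' frame, for `χ₂` automorphic, ★ p864188's `hEXP` ∀-row holds as soon as every τ-admissible generator lies in a
finite-dimensional `K_max`-stable block of continuous bounded pair-sections carrying the gauge letters — the (R)′ `hEXP` row «★ modulo the τ-ports (pure type) and K2E1-p12's laws».
[cite: MoeglinWaldspurger1995, IV.1.9–IV.1.11] [cite: BernsteinLapid2019, Thm 2.3, §4] -/
theorem hEXP_tauRow_of_gauge_blocks
    [MeasurableSpace (quasiSplit (↥(maximalRealSubfield L)) L (IsCMField.complexConj L) 3).Adelic] [BorelSpace (quasiSplit (↥(maximalRealSubfield L)) L (IsCMField.complexConj L) 3).Adelic]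
    (μ : Measure (quasiSplit (↥(maximalRealSubfield L)) L (IsCMField.complexConj L) 3).automorphicQuotient) [(quasiSplit (↥(maximalRealSubfield L)) L (IsCMField.complexConj L) 3).IsAutomorphicMeasure μ]
    (νG : Measure (quasiSplit (↥(maximalRealSubfield L)) L (IsCMField.complexConj L) 3).Adelic) [νG.IsHaarMeasure] [νG.IsInvInvariant] [SFinite νG]
    (ν : Measure ↥(adelicUnipotent (↥(maximalRealSubfield L)) L (IsCMField.complexConj L) 3)) [ν.IsHaarMeasure] [ν.IsMulRightInvariant] [ν.IsInvInvariant]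
    {𝓕 : Set ↥(adelicUnipotent (↥(maximalRealSubfield L)) L (IsCMField.complexConj L) 3)}
    (h𝓕N : IsFundamentalDomain ↥(rationalUnipotent (↥(maximalRealSubfield L)) L (IsCMField.complexConj L) 3) 𝓕 ν) (h𝓕c : IsCompact (closure 𝓕)) (h𝓕₀ : ν 𝓕 ≠ 0)
    {β : (quasiSplit (↥(maximalRealSubfield L)) L (IsCMField.complexConj L) 3).Adelic → ℝ≥0∞}
    (hβ : IsCoveringWeight ↥((arithmeticBorel (↥(maximalRealSubfield L)) L (IsCMField.complexConj L) 3).map (quasiSplit (↥(maximalRealSubfield L)) L (IsCMField.complexConj L) 3).arithmeticSubgroup.subtype) β)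
    {μZ : Measure (borelQuotient (↥(maximalRealSubfield L)) L (IsCMField.complexConj L) 3)} [SFinite μZ]
    (hμZ : ∀ f : borelQuotient (↥(maximalRealSubfield L)) L (IsCMField.complexConj L) 3 → ℝ≥0∞, Measurable f → ∫⁻ z, f z ∂μZ = ∫⁻ g, β g * f (toBorelQuotient (↥(maximalRealSubfield L)) L (IsCMField.complexConj L) 3 g) ∂νG)
    {χ₁ : HeckeCharacter L} {χ₂ : ↥(TorusDict.torus (IsCMField.complexConj L)) →ₜ* ℂˣ} (hχ₂ : TorusDict.IsAutomorphic (IsCMField.complexConj L) χ₂)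
    (hBLOCK : ∀ (U₀ : Subgroup ↥(finAdelic (↥(maximalRealSubfield L)) L (IsCMField.complexConj L) 3 ((StdForm.antidiagonal 3).over L))) (_ : IsTauLevel L U₀)
      (φ : (quasiSplit (↥(maximalRealSubfield L)) L (IsCMField.complexConj L) 3).Adelic → ℂ) (_ : φ ∈ chiSectionSpacePair χ₁ χ₂ (tauLevel L U₀) ((1 : ↥(tauLevel L U₀) →* ℂ) : ↥(tauLevel L U₀) → ℂ)) (_ : Continuous φ)
      (_ : IsArchFinite L φ),
      ∃ V : Submodule ℂ ((quasiSplit (↥(maximalRealSubfield L)) L (IsCMField.complexConj L) 3).Adelic → ℂ), FiniteDimensional ℂ ↥V ∧ φ ∈ V ∧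
        (∀ k ∈ ((standardMaximalCompactGL 3 L).comap (adelicVal (↥(maximalRealSubfield L)) L (IsCMField.complexConj L) 3 ((StdForm.antidiagonal 3).over L)) : Subgroup (quasiSplit (↥(maximalRealSubfield L)) L (IsCMField.complexConj L) 3).Adelic), ∀ ψ ∈ V, (fun x => ψ (x * k)) ∈ V) ∧
        (∀ ψ ∈ V, IsChiSectionPair χ₁ χ₂ ψ) ∧ (∀ ψ ∈ V, Continuous ψ) ∧ (∀ ψ ∈ V, ∃ M : ℝ, ∀ x, ‖ψ x‖ ≤ M) ∧
        (∀ z₀ : ℂ, ∃ η : GL (Fin 3) (AdeleRing (𝓞 L) L) → ℝ, IsTestFunctionGL 3 L η ∧ (∀ g, 0 ≤ η g) ∧ (∀ g, η g⁻¹ = η g) ∧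
      ∃ s : ℂ → ℂ, Differentiable ℂ s ∧ s z₀ ≠ 0 ∧ ∀ z : ℂ, ∀ φ ∈ V, ∀ x : (quasiSplit (↥(maximalRealSubfield L)) L (IsCMField.complexConj L) 3).Adelic, (∫ y, (fun y : (quasiSplit (↥(maximalRealSubfield L)) L (IsCMField.complexConj L) 3).Adelic => orbitalSmoothing νG (fun x : (quasiSplit (↥(maximalRealSubfield L)) L (IsCMField.complexConj L) 3).Adelic => ((η (adelicVal (↥(maximalRealSubfield L)) L (IsCMField.complexConj L) 3 ((StdForm.antidiagonal 3).over L) x) : ℝ) : ℂ)) (fun x : (quasiSplit (↥(maximalRealSubfield L)) L (IsCMField.complexConj L) 3).Adelic => ((η (adelicVal (↥(maximalRealSubfield L)) L (IsCMField.complexConj L) 3 ((StdForm.antidiagonal 3).over L) x) : ℝ) : ℂ)) y) y * flatSectionU φ z (x * y) ∂νG) = s z * flatSectionU φ z x) ∧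
        (∃ η : GL (Fin 3) (AdeleRing (𝓞 L) L) → ℝ, IsTestFunctionGL 3 L η ∧ (∀ g, 0 ≤ η g) ∧ (∀ g, η g⁻¹ = η g) ∧
      ∃ s : ℂ → ℂ, Differentiable ℂ s ∧ (∃ z₁ z₂ : ℂ, s z₁ ≠ s z₂) ∧ ∀ z : ℂ, ∀ φ ∈ V, ∀ x : (quasiSplit (↥(maximalRealSubfield L)) L (IsCMField.complexConj L) 3).Adelic, (∫ y, (fun y : (quasiSplit (↥(maximalRealSubfield L)) L (IsCMField.complexConj L) 3).Adelic => orbitalSmoothing νG (fun x : (quasiSplit (↥(maximalRealSubfield L)) L (IsCMField.complexConj L) 3).Adelic => ((η (adelicVal (↥(maximalRealSubfield L)) L (IsCMField.complexConj L) 3 ((StdForm.antidiagonal 3).over L) x) : ℝ) : ℂ)) (fun x : (quasiSplit (↥(maximalRealSubfield L)) L (IsCMField.complexConj L) 3).Adelic => ((η (adelicVal (↥(maximalRealSubfield L)) L (IsCMField.complexConj L) 3 ((StdForm.antidiagonal 3).over L) x) : ℝ) : ℂ)) y) y * flatSectionU φ z (x * y) ∂νG) = s z * flatSectionU φ z x))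 :
    ∀ (U₀ : Subgroup ↥(finAdelic (↥(maximalRealSubfield L)) L (IsCMField.complexConj L) 3 ((StdForm.antidiagonal 3).over L))) (_ : IsTauLevel L U₀)
      (φ : (quasiSplit (↥(maximalRealSubfield L)) L (IsCMField.complexConj L) 3).Adelic → ℂ) (_ : φ ∈ chiSectionSpacePair χ₁ χ₂ (tauLevel L U₀) ((1 : ↥(tauLevel L U₀) →* ℂ) : ↥(tauLevel L U₀) → ℂ)) (_ : Continuous φ)
      (_ : IsArchFinite L φ)
      (Ec : ℂ → (quasiSplit (↥(maximalRealSubfield L)) L (IsCMField.complexConj L) 3).Adelic → ℂ) (Sp : Finset ℂ) (_ : ∀ s ∈ Sp, s.im = 0 ∧ 1 < s.re ∧ s.re ≤ 2)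
      (_ : ∀ g, DifferentiableOn ℂ (fun z => Ec z g) ({z : ℂ | 1 < z.re} \ (↑Sp : Set ℂ)))
      (_ : ∀ z : ℂ, 2 < z.re → Ec z = eisensteinSeriesU (flatSectionU φ z))
      (Fp : (quasiSplit (↥(maximalRealSubfield L)) L (IsCMField.complexConj L) 3).Adelic → ℂ → ℂ) (_ : ∀ g, AnalyticAt ℂ (Fp g) ((3 : ℂ) / 2))
      (_ : ∀ g, Fp g =ᶠ[𝓝[≠] ((3 : ℂ) / 2)] fun z => (z - (3 : ℂ) / 2) * Ec z g)
      (f : (quasiSplit (↥(maximalRealSubfield L)) L (IsCMField.complexConj L) 3).L2 μ) (_ : (f : (quasiSplit (↥(maximalRealSubfield L)) L (IsCMField.complexConj L) 3).automorphicQuotient → ℂ) =ᵐ[μ] fun x => Fp (Quotient.out (x : (quasiSplit (↥(maximalRealSubfield L)) L (IsCMField.complexConj L) 3).Adelic ⧸ (quasiSplit (↥(maximalRealSubfield L)) L (IsCMField.complexConj L) 3).quotientSubgroup))⁻¹ ((3 : ℂ) / 2)), (∀ z ∈ ({z : ℂ | 1 < z.re} \ (↑Sp : Set ℂ)), Continuous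 (Ec z)) ∧ (∀ z₁ ∈ ({z : ℂ | 1 < z.re} \ (↑Sp : Set ℂ)), ∀ K : Set (quasiSplit (↥(maximalRealSubfield L)) L (IsCMField.complexConj L) 3).Adelic, IsCompact K → ∃ V ∈ 𝓝 z₁, ∃ M : ℝ, ∀ z ∈ V, ∀ g ∈ K, ‖Ec z g‖ ≤ M) :=
  hEXP_tauRow_of_exportsRow L μ (exportsTauRow_of_gauge_blocks L μ νG ν h𝓕N h𝓕c h𝓕₀ hβ hμZ hχ₂ hBLOCK)

end Summit.HodgeConjecture.HodgeConjecture.R90.S8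

end
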